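import Summits.RiemannHypothesis.RiemannHypothesis.Theorems.PfPersistenceMirrorWindow
import Summits.RiemannHypothesis.RiemannHypothesis.Theorems.PfPersistenceAffineMatching
import HarnessLib

/-!
# PF persistence — BOUNDED-INDEX readers reject heavy dials (pub-rhpf, cand-6 gen 3)

**HONEST FRAMING. This is a long-odds MECHANISM SEARCH; no RH claims.** RH-free bookkeeping about the cell's
observatory records; nothing here bears on the truth of RH. PROVED = kernel-checked here or in the imported files.

`PfPersistenceMirrorWindow` showed that at the mirror window `a = log p` a dial `K` at `p` acts DIAGONALLY,
`Q ↦ Q − (K − 1) w(p) · diag((−1)^n)`, and that readers allowing AT MOST ONE negative direction (after a fixed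
offset) reject every heavy dial once `N ≥ 3`. This file removes the "one": for every INDEX BUDGET `r`,

* §1 (PROVED `parity_form_neg`) past the explicit threshold `Σ|entries| + 1 ≤ ±(K − 1) w(p)` the dialled block minus
  ANY offset is negative definite on the whole coordinate subspace of even-indexed (resp. odd-indexed) modes;
* §2 (PROVED `exists_paritySupported_orth`) that subspace has dimension `> r` as soon as `2r + parity ≤ N`, so it
  meets every codimension-`r` subspace (rank–nullity, `exists_ne_zero_map_eq_zero`);
* §3 (PROVED `heavyDial_negative_not_mem_of_indexLE`) hence a class whose members have, at every window, AT MOST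
  `r` NEGATIVE DIRECTIONS after subtracting a fixed offset `M₀` (positive semidefinite on the joint kernel of `r`
  linear constraints: `E_r(A₀) ≥ 0`-type pole-free readers, `ε_{r+1} ≥ 0`-type readers, any finite inertia budget)
  contains NO heavy prime dial of `ζ` of either sign at a mirror window with `N ≥ 2r + 1`, although those dials are
  arithmetic and detectably negative. Finite-index readers are therefore immune BY THEOREM to the heavy-dial
  witness family of wall W1 / the co-convex and fibrewise barriers; their status rests on small dials (DATA).
  A SOUNDNESS statement about a reader class on one witness family — not a closure, not a separation claim.
-/

set_option linter.dupNamespace false  -- the mandated namespace repeats `RiemannHypothesis`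

noncomputable section

open Real Finset Matrix

namespace Summit.RiemannHypothesis.RiemannHypothesis.Theorems.PfPersistence

/-! ## §1 Negativity on a parity-supported coordinate subspace -/

/-- PROVED: a square is at most the squared norm. [folklore] -/
theorem mul_self_le_dotSelf {n : ℕ} (v : Fin n → ℝ) (i : Fin n) : v i * v i ≤ v ⬝ᵥ v :=
  Finset.single_le_sum (f := fun j => v j * v j) (fun j _ => mul_self_nonneg (v j)) (Finset.mem_univ i)

/-- PROVED: a non-zero vector has positive squared norm. [folklore] -/
theorem dotSelf_pos_of_ne_zero {n : ℕ} {v : Fin n → ℝ} (hv : v ≠ 0) : 0 < v ⬝ᵥ v := by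
  obtain ⟨i, hi⟩ := Function.ne_iff.1 hv
  exact lt_of_lt_of_le (mul_self_pos.2 hi) (mul_self_le_dotSelf v i)

/-- PROVED: crude bound of a quadratic form by the sum of the absolute entries times the squared norm. [folklore] -/
theorem form_le_sumAbs_mul_dotSelf {n : ℕ} (B : Matrix (Fin n) (Fin n) ℝ) (v : Fin n → ℝ) :
    v ⬝ᵥ (B *ᵥ v) ≤ (∑ i, ∑ j, |B i j|) * (v ⬝ᵥ v) := by
  have hterm : ∀ i j, v i * (B i j * v j) ≤ |B i j| * (v ⬝ᵥ v) := by
    intro i j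
    have h1 : v i * (B i j * v j) ≤ |B i j| * (|v i| * |v j|) := by
      calc v i * (B i j * v j) ≤ |v i * (B i j * v j)| := le_abs_self _
        _ = |B i j| * (|v i| * |v j|) := by
            rw [abs_mul, abs_mul]
            ring
    have h2 : |v i| * |v j| ≤ v ⬝ᵥ v := by
      nlinarith [two_mul_le_add_sq (|v i|) (|v j|), abs_mul_abs_self (v i), abs_mul_abs_self (v j),
        mul_self_le_dotSelf v i, mul_self_le_dotSelf v j, abs_nonneg (v i), abs_nonneg (v j)]
    nlinarith [abs_nonneg (B i j)]
  have hexp : v ⬝ᵥ (B *ᵥ v) = ∑ i, ∑ j, v i * (B i j * v j) := by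
    simp only [Matrix.mulVec, dotProduct, Finset.mul_sum]
  rw [hexp]
  calc ∑ i, ∑ j, v i * (B i j * v j) ≤ ∑ i, ∑ j, |B i j| * (v ⬝ᵥ v) :=
        Finset.sum_le_sum fun i _ => Finset.sum_le_sum fun j _ => hterm i j
    _ = (∑ i, ∑ j, |B i j|) * (v ⬝ᵥ v) := by
        rw [Finset.sum_mul]
        refine Finset.sum_congr rfl fun i _ => ?_
        rw [Finset.sum_mul]

/-- PROVED: `(−1)^i = (−1)^b` when `i ≡ b (mod 2)`. [folklore] -/
theorem neg_one_pow_of_mod_two_eq {i b : ℕ} (h : i % 2 = b) : (-1 : ℝ) ^ i = (-1) ^ b := by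
  rw [← Nat.mod_add_div i 2, h, pow_add, pow_mul]
  norm_num

/-- PROVED: on vectors supported on the indices of parity `b`, the alternating diagonal form is `(−1)^b ‖v‖²`.
[folklore] -/
theorem altDiagonal_form_of_paritySupported {n : ℕ} (b : ℕ) (v : Fin n → ℝ)
    (hv : ∀ i : Fin n, (i : ℕ) % 2 ≠ b → v i = 0) :
    v ⬝ᵥ ((Matrix.diagonal fun k : Fin n => (-1 : ℝ) ^ (k : ℕ)) *ᵥ v) = (-1) ^ b * (v ⬝ᵥ v) := by
  simp only [dotProduct, Matrix.mulVec_diagonal, Finset.mul_sum]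
  refine Finset.sum_congr rfl fun i _ => ?_
  by_cases hi : (i : ℕ) % 2 = b
  · rw [neg_one_pow_of_mod_two_eq hi]
    ring
  · rw [hv i hi]
    ring

/-- **PROVED — NEGATIVITY ON A WHOLE PARITY SUBSPACE.** If `Σ_{ij} |B_{ij}| + 1 ≤ (−1)^b Δ` then
`B − Δ · diag((−1)^n)` is negative on every non-zero vector supported on the indices of parity `b`. [folklore] -/
theorem parity_form_neg {n : ℕ} (B : Matrix (Fin n) (Fin n) ℝ) (Δ : ℝ) (b : ℕ)
    (hΔ : (∑ i, ∑ j, |B i j|) + 1 ≤ (-1) ^ b * Δ) (v : Fin n → ℝ)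
    (hv : ∀ i : Fin n, (i : ℕ) % 2 ≠ b → v i = 0) (hv0 : v ≠ 0) :
    v ⬝ᵥ ((B - Δ • Matrix.diagonal fun k : Fin n => (-1 : ℝ) ^ (k : ℕ)) *ᵥ v) < 0 := by
  rw [rayleigh_sub_smul, altDiagonal_form_of_paritySupported b v hv]
  have hB := form_le_sumAbs_mul_dotSelf B v
  have hpos := dotSelf_pos_of_ne_zero hv0
  nlinarith

/-- PROVED: at the mirror window, `Q(dial p K w) − M₀ = (Q(w) − M₀) − (K − 1) w(p) · diag((−1)^n)`. [folklore] -/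
theorem evenBlock_dial_mirror_sub {p : ℕ} (hp : 2 ≤ p) {win : Window} (hwin : win.a = Real.log p) (K : ℝ)
    (w : Weights) (M₀ : Matrix (Fin (win.N + 1)) (Fin (win.N + 1)) ℝ) :
    evenBlock (dial p K w) win - M₀ =
      (evenBlock w win - M₀) - ((K - 1) * w p) • Matrix.diagonal fun n : Fin (win.N + 1) => (-1 : ℝ) ^ (n : ℕ) := by
  rw [evenBlock_dial_mirror hp hwin, sub_right_comm]

/-! ## §2 A parity subspace of dimension `> r` meets every codimension-`r` subspace -/

/-- **PROVED — rank–nullity on the parity subspace:** if the indices `b, b + 2, …, b + 2r` are available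
(`2r + b < n`), then for any `r` linear constraints there is a NON-ZERO vector supported on the indices of parity
`b ≤ 1` satisfying all of them. [folklore] -/
theorem exists_paritySupported_orth {n r b : ℕ} (hb : b ≤ 1) (hn : 2 * r + b < n)
    (u : Fin r → (Fin n → ℝ)) :
    ∃ v : Fin n → ℝ, v ≠ 0 ∧ (∀ i : Fin n, (i : ℕ) % 2 ≠ b → v i = 0) ∧ ∀ k, v ⬝ᵥ u k = 0 := by
  -- the available indices of parity `b`
  have hidx : ∀ m : Fin (r + 1), 2 * (m : ℕ) + b < n := fun m => by have := m.isLt; omega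
  obtain ⟨idx, hidx_val⟩ : ∃ idx : Fin (r + 1) → Fin n, ∀ m, (idx m : ℕ) = 2 * (m : ℕ) + b :=
    ⟨fun m => ⟨2 * (m : ℕ) + b, hidx m⟩, fun m => rfl⟩
  -- the constraint map on coefficient vectors
  obtain ⟨ψ, hψ⟩ : ∃ ψ : (Fin (r + 1) → ℝ) →ₗ[ℝ] (Fin r → ℝ),
      ∀ c k, ψ c k = ∑ m, c m * u k (idx m) :=
    ⟨{ toFun := fun c k => ∑ m, c m * u k (idx m)
       map_add' := fun c c' => by
         ext k
         simp only [Pi.add_apply, add_mul, Finset.sum_add_distrib]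
       map_smul' := fun a c => by
         ext k
         simp only [Pi.smul_apply, smul_eq_mul, RingHom.id_apply, Finset.mul_sum, mul_assoc] },
      fun c k => rfl⟩
  obtain ⟨c, hc0, hcψ⟩ := exists_ne_zero_map_eq_zero (ι := Fin r) (m := r + 1) (by simp) ψ
  -- the vector with coefficients `c` on the indices `idx m`
  refine ⟨fun i => ∑ m : Fin (r + 1), if (i : ℕ) = 2 * (m : ℕ) + b then c m else 0, ?_, ?_, ?_⟩
  · -- non-zero
    obtain ⟨m, hm⟩ := Function.ne_iff.1 hc0
    intro h
    have hval := congrFun h (idx m)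
    simp only [Pi.zero_apply] at hval
    rw [Finset.sum_eq_single m (fun m' _ hm' => if_neg fun h' => hm' (Fin.ext (by
        rw [hidx_val m] at h'; omega))) (fun h' => absurd (Finset.mem_univ m) h'),
      if_pos (hidx_val m)] at hval
    exact hm hval
  · -- supported on parity `b`
    intro i hi
    refine Finset.sum_eq_zero fun m _ => if_neg fun h => hi ?_
    omega
  · -- orthogonal to every constraint
    intro k
    have hk : ∑ m, c m * u k (idx m) = 0 := by rw [← hψ c k, hcψ]; rfl
    refine Eq.trans ?_ hk
    simp only [dotProduct, Finset.sum_mul]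
    rw [Finset.sum_comm]
    refine Finset.sum_congr rfl fun m _ => ?_
    rw [Finset.sum_eq_single (idx m) (fun i _ hi => by
        rw [if_neg fun h => hi (Fin.ext (by rw [hidx_val m]; exact h)), zero_mul])
      (fun h => absurd (Finset.mem_univ _) h), if_pos (hidx_val m)]

/-- PROVED: the basis vector at index `b` is supported on parity `b ≤ 1` and non-zero. [folklore] -/
theorem single_paritySupported {n b : ℕ} (hb : b ≤ 1) (hbn : b < n) :
    (Pi.single (⟨b, hbn⟩ : Fin n) (1 : ℝ) : Fin n → ℝ) ≠ 0 ∧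
      ∀ i : Fin n, (i : ℕ) % 2 ≠ b → (Pi.single (⟨b, hbn⟩ : Fin n) (1 : ℝ) : Fin n → ℝ) i = 0 := by
  refine ⟨fun h => ?_, fun i hi => ?_⟩
  · have := congrFun h ⟨b, hbn⟩
    simp at this
  · rw [Pi.single_apply, if_neg]
    intro h
    apply hi
    rw [h]
    show b % 2 = b
    omega

/-! ## §3 Finite-index readers reject heavy dials -/

/-- **PROVED — READERS WITH AT MOST `r` NEGATIVE DIRECTIONS CONTAIN NO HEAVY PRIME DIAL OF `ζ`.** Fix an index
budget `r`, offsets `M₀` (one matrix per window) and a class `S` each of whose members is, at EVERY window,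
positive semidefinite on the joint kernel of some `r` linear functionals after subtracting `M₀` (i.e. has at most
`r` negative directions there). Then for every prime `p` and every mirror window `(log p, N)` with `N ≥ 2r + 1`
there is `C > 0` such that every dial `K` at `p` with `|K − 1| ≥ C` gives an ARITHMETIC, DETECTABLY NEGATIVE
datum NOT in `S`. [folklore] -/
theorem heavyDial_negative_not_mem_of_indexLE {S : Set Datum} (r : ℕ)
    (M₀ : (win : Window) → Matrix (Fin (win.N + 1)) (Fin (win.N + 1)) ℝ)
    (hS : S ⊆ {d | ∀ win : Window, ∃ u : Fin r → (Fin (win.N + 1) → ℝ),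
      ∀ v : Fin (win.N + 1) → ℝ, (∀ k, v ⬝ᵥ u k = 0) → 0 ≤ v ⬝ᵥ ((d win - M₀ win) *ᵥ v)})
    {p : ℕ} (hp : p.Prime) {win : Window} (hwin : win.a = Real.log p) (hN : 2 * r + 1 ≤ win.N) :
    ∃ C : ℝ, 0 < C ∧ ∀ K : ℝ, C ≤ |K - 1| →
      datumOf (dial p K zetaWeights) ∈ arithDialSpace ∧ DetectablyNegative (datumOf (dial p K zetaWeights)) ∧
        datumOf (dial p K zetaWeights) ∉ S := by
  have hp2 : 2 ≤ p := hp.two_le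
  have hwp : 0 < zetaWeights p := zetaWeights_pos_of_prime hp
  obtain ⟨B, hB⟩ : ∃ B : Matrix (Fin (win.N + 1)) (Fin (win.N + 1)) ℝ, B = evenBlock zetaWeights win - M₀ win :=
    ⟨_, rfl⟩
  obtain ⟨Z, hZ⟩ : ∃ Z : Matrix (Fin (win.N + 1)) (Fin (win.N + 1)) ℝ, Z = evenBlock zetaWeights win - 0 :=
    ⟨_, rfl⟩
  obtain ⟨β, hβ⟩ : ∃ β : ℝ, β = (∑ i, ∑ j, |B i j|) + 1 := ⟨_, rfl⟩
  obtain ⟨γ, hγ⟩ : ∃ γ : ℝ, γ = (∑ i, ∑ j, |Z i j|) + 1 := ⟨_, rfl⟩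
  have hβ0 : 0 < β := by rw [hβ]; positivity
  have hγ0 : 0 < γ := by rw [hγ]; positivity
  refine ⟨(β + γ) / zetaWeights p, by positivity, fun K hK => ?_⟩
  have hKw : β + γ ≤ |K - 1| * zetaWeights p := by rwa [div_le_iff₀ hwp] at hK
  -- the parity bit of the sign of `K − 1`, and the signed threshold
  obtain ⟨b, hb1, hbΔ⟩ : ∃ b : ℕ, b ≤ 1 ∧ β + γ ≤ (-1) ^ b * ((K - 1) * zetaWeights p) := by
    rcases le_or_gt 0 (K - 1) with hK0 | hK0
    · refine ⟨0, zero_le_one, ?_⟩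
      rw [abs_of_nonneg hK0] at hKw
      simpa using hKw
    · refine ⟨1, le_rfl, ?_⟩
      rw [abs_of_neg hK0] at hKw
      linarith
  have hbN : b < win.N + 1 := by omega
  have h2rb : 2 * r + b < win.N + 1 := by omega
  have hβΔ : (∑ i, ∑ j, |B i j|) + 1 ≤ (-1) ^ b * ((K - 1) * zetaWeights p) := by rw [← hβ]; linarith
  have hγΔ : (∑ i, ∑ j, |Z i j|) + 1 ≤ (-1) ^ b * ((K - 1) * zetaWeights p) := by rw [← hγ]; linarith
  refine ⟨datumOf_dial_zeta_mem_arithDialSpace p K, ?_, ?_⟩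
  · -- detectably negative: the basis vector `e_b` at the mirror window (offset `0`)
    obtain ⟨hv0, hv⟩ := single_paritySupported (n := win.N + 1) hb1 hbN
    refine ⟨win, Pi.single (⟨b, hbN⟩ : Fin (win.N + 1)) 1, ?_⟩
    have h := parity_form_neg Z ((K - 1) * zetaWeights p) b hγΔ _ hv hv0
    rw [hZ, ← evenBlock_dial_mirror_sub hp2 hwin K zetaWeights 0, sub_zero] at h
    exact h
  · -- not in `S`: the parity-`b` subspace meets the joint kernel of the `r` constraints
    intro hmem
    obtain ⟨u, hu⟩ := hS hmem win
    obtain ⟨v, hv0, hv, hvu⟩ := exists_paritySupported_orth hb1 h2rb u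
    have h := parity_form_neg B ((K - 1) * zetaWeights p) b hβΔ v hv hv0
    rw [hB, ← evenBlock_dial_mirror_sub hp2 hwin K zetaWeights (M₀ win)] at h
    exact absurd (hu v hvu) (not_le.2 h)

/-- PROVED (the same with the mirror window built in): for every prime `p` and every `N ≥ 2r + 1`. [folklore] -/
theorem heavyDial_negative_not_mem_of_indexLE' {S : Set Datum} (r : ℕ)
    (M₀ : (win : Window) → Matrix (Fin (win.N + 1)) (Fin (win.N + 1)) ℝ)
    (hS : S ⊆ {d | ∀ win : Window, ∃ u : Fin r → (Fin (win.N + 1) → ℝ),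
      ∀ v : Fin (win.N + 1) → ℝ, (∀ k, v ⬝ᵥ u k = 0) → 0 ≤ v ⬝ᵥ ((d win - M₀ win) *ᵥ v)})
    {p : ℕ} (hp : p.Prime) {N : ℕ} (hN : 2 * r + 1 ≤ N) :
    ∃ C : ℝ, 0 < C ∧ ∀ K : ℝ, C ≤ |K - 1| →
      datumOf (dial p K zetaWeights) ∈ arithDialSpace ∧ DetectablyNegative (datumOf (dial p K zetaWeights)) ∧
        datumOf (dial p K zetaWeights) ∉ S :=
  heavyDial_negative_not_mem_of_indexLE r M₀ hS hp
    (win := ⟨Real.log p, N, Real.log_pos (by exact_mod_cast hp.one_lt)⟩) rfl hN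

/-- **PROVED — the PSD special case `r = 0`:** a class of records that are positive semidefinite after the offset
at every window (e.g. `WP` itself with `M₀ = 0`) contains no heavy prime dial at any mirror window `N ≥ 1` —
the familiar convex-cone case, recovered from the index bookkeeping. [folklore] -/
theorem heavyDial_negative_not_mem_of_psd {S : Set Datum}
    (M₀ : (win : Window) → Matrix (Fin (win.N + 1)) (Fin (win.N + 1)) ℝ)
    (hS : S ⊆ {d | ∀ win : Window, ∀ v : Fin (win.N + 1) → ℝ, 0 ≤ v ⬝ᵥ ((d win - M₀ win) *ᵥ v)})
    {p : ℕ} (hp : p.Prime) {N : ℕ} (hN : 1 ≤ N) :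
    ∃ C : ℝ, 0 < C ∧ ∀ K : ℝ, C ≤ |K - 1| →
      datumOf (dial p K zetaWeights) ∈ arithDialSpace ∧ DetectablyNegative (datumOf (dial p K zetaWeights)) ∧
        datumOf (dial p K zetaWeights) ∉ S := by
  refine heavyDial_negative_not_mem_of_indexLE' 0 M₀ (fun d hd win => ⟨Fin.elim0, fun v _ => hS hd win v⟩) hp
    (N := N) (by omega)

end Summit.RiemannHypothesis.RiemannHypothesis.Theorems.PfPersistence

end
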